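import Literature.AlgebraicGeometry.Motives.MixedHodgeStructureSplitOverQFunctorial
import Literature.AlgebraicGeometry.Motives.MixedHodgeStructureIsomorphismTheorems
import Literature.AlgebraicGeometry.Motives.MixedHodgeStructurePi
import HarnessLib

/-!
# A `ℚ`-split mixed Hodge structure is the direct sum of its graded pieces: `H ≅ ⊕ₙ Gr^W_n H`

Green–Griffiths–Kerr, *Mumford–Tate groups and domains*, §I.C (I.C.7): `V^split := ⊕ᵢ Gr^W_i V`;
footnote 3: "the case of `ℚ`-split MHS, i.e., 'general Hodge structures'"; (I.C.8): the splitting induced by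
the Deligne bigrading is defined over `ℂ` only, the passage to `W`-graded pieces over `ℚ`. Cattani–El
Zein–Griffiths–Lê, Thm. 3.2.18 (MHS form an abelian category: finite direct sums), Ex. 3.2.23 (2)
(direct sums), Def. 3.2.15 (`Gr^W_n`).

For a `ℚ`-split `H` (`IsSplitOverQ`, `Motives/MixedHodgeStructureSplitOverQ`: each `E_n = ⊕_{p+q=n} I^{p,q}`
is defined over `ℚ`) this file constructs the canonical splitting of the weight filtration over `ℚ`:

* §1 `Hom.piMap` — the direct sum `⊕ⱼ gⱼ : ⊕ⱼ Hⱼ → ⊕ⱼ H'ⱼ` of morphisms, bijective when all `gⱼ` are.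
* §2 **the weight pieces** `h.weightForm n ⊆ V` (THE `ℚ`-form of `E_n`, unique: `IsSplitOverQ.eq_weightForm`)
  and the sub-MHS `h.weightPiece n`; `U_n ⊆ W_n`, `U_n ∩ W_{n-1} = 0`, `W_{n-1} ⊕ U_n = W_n`, `U_n` is pure of
  weight `n`; the `U_n` are independent with `Σ U_n = V`; only finitely many are non-zero.
* §3 **`⊕_{n ∈ s} U_n ⥲ H`** is a bijective morphism of MHS for every finite set `s` of weights carrying all
  non-zero pieces (`IsSplitOverQ.piWeightPieceHom`, `…_bijective`), and **`U_n ⥲ Gr^W_n H`**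
  (`IsSplitOverQ.weightPieceGrHom`, `…_bijective`); hence **`H ≅ ⊕_{n ∈ s} Gr^W_n H`**
  (`IsSplitOverQ.exists_hom_pi_gr_bijective`).
* §4 direct sums of `ℚ`-split MHS are `ℚ`-split (`isSplitOverQ_pi`), and so are the summands
  (`IsSplitOverQ.of_pi`); `E_n(⊕ⱼ Hⱼ) = Π E_n(Hⱼ)` (`deligneE_pi`).

All statements proved; definitions with bodies; no named facts, no instances.

## References

* [GreenGriffithsKerr2012] M. Green, P. Griffiths, M. Kerr, Mumford–Tate groups and domains (2012), §I.C
  (I.C.7)–(I.C.8), footnote 3.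
* [CattaniElZeinGriffithsLe2014] E. Cattani et al. (eds.), Hodge Theory (2014), Thm. 3.2.18, Def. 3.2.15,
  Ex. 3.2.23 (2).
-/

noncomputable section

open scoped TensorProduct

namespace Literature.AlgebraicGeometry.Motives

namespace MixedHodgeStructure

open Literature.LinearAlgebra.BaseChange (baseChange_iSup baseChange_sup baseChange_inf)

universe u v v' w

/-! ### §1 Direct sums of morphisms -/

namespace Hom

variable {ι : Type w} [Fintype ι] [DecidableEq ι]
variable {W : ι → Type v} [∀ j, AddCommGroup (W j)] [∀ j, Module ℚ (W j)]
variable {W' : ι → Type v'} [∀ j, AddCommGroup (W' j)] [∀ j, Module ℚ (W' j)]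
variable {H : ∀ j, MixedHodgeStructure (W j)} {H' : ∀ j, MixedHodgeStructure (W' j)}

/-- **The direct sum `⊕ⱼ gⱼ : ⊕ⱼ Hⱼ → ⊕ⱼ H'ⱼ` of a family of morphisms.** [cite: CattaniElZeinGriffithsLe2014, Thm. 3.2.18] -/
def piMap (g : ∀ j, Hom (H j) (H' j)) : Hom (pi H) (pi H') :=
  piLift H' fun j => (g j).comp (proj H j)

/-- `(⊕ⱼ gⱼ)(x)_j = gⱼ(x_j)` (by `rfl`). [cite: CattaniElZeinGriffithsLe2014, Thm. 3.2.18] -/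
@[simp]
theorem piMap_toLinearMap_apply (g : ∀ j, Hom (H j) (H' j)) (x : ∀ j, W j) (j : ι) :
    (piMap g).toLinearMap x j = (g j).toLinearMap (x j) := rfl

/-- `⊕ⱼ gⱼ` is injective when all `gⱼ` are. [cite: CattaniElZeinGriffithsLe2014, Thm. 3.2.18] -/
theorem piMap_injective (g : ∀ j, Hom (H j) (H' j)) (hg : ∀ j, Function.Injective (g j).toLinearMap) :
    Function.Injective (piMap g).toLinearMap :=
  fun x y hxy => funext fun j => hg j (by rw [← piMap_toLinearMap_apply, ← piMap_toLinearMap_apply, hxy])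

/-- `⊕ⱼ gⱼ` is surjective when all `gⱼ` are. [cite: CattaniElZeinGriffithsLe2014, Thm. 3.2.18] -/
theorem piMap_surjective (g : ∀ j, Hom (H j) (H' j)) (hg : ∀ j, Function.Surjective (g j).toLinearMap) :
    Function.Surjective (piMap g).toLinearMap := fun y =>
  ⟨fun j => (hg j (y j)).choose, funext fun j => (hg j (y j)).choose_spec⟩

/-- **`⊕ⱼ gⱼ` is bijective when all `gⱼ` are.** [cite: CattaniElZeinGriffithsLe2014, Thm. 3.2.18] -/
theorem piMap_bijective (g : ∀ j, Hom (H j) (H' j)) (hg : ∀ j, Function.Bijective (g j).toLinearMap) :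
    Function.Bijective (piMap g).toLinearMap :=
  ⟨piMap_injective g fun j => (hg j).1, piMap_surjective g fun j => (hg j).2⟩

end Hom

/-! ### §2 The weight pieces `U_n` of a `ℚ`-split mixed Hodge structure -/

variable {V : Type u} [AddCommGroup V] [Module ℚ V] {H : MixedHodgeStructure V}

namespace IsSplitOverQ

/-- **The weight piece `U_n ⊆ V`** of a `ℚ`-split MHS: the `ℚ`-form of `E_n = ⊕_{p+q=n} I^{p,q}`
(unique, `eq_weightForm`). [cite: GreenGriffithsKerr2012, §I.C (I.C.7)–(I.C.8)] -/
def weightForm (h : H.IsSplitOverQ) (n : ℤ) : Submodule ℚ V :=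
  (h n).choose

/-- `(U_n)_ℂ = E_n`. [cite: GreenGriffithsKerr2012, §I.C (I.C.7)–(I.C.8)] -/
theorem baseChange_weightForm (h : H.IsSplitOverQ) (n : ℤ) : (h.weightForm n).baseChange ℂ = H.deligneE n :=
  (h n).choose_spec

/-- **Uniqueness**: any `ℚ`-form of `E_n` is `U_n`. [cite: GreenGriffithsKerr2012, §I.C (I.C.7)–(I.C.8)] -/
theorem eq_weightForm (h : H.IsSplitOverQ) {n : ℤ} {U : Submodule ℚ V} (hU : U.baseChange ℂ = H.deligneE n) :
    U = h.weightForm n :=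
  eq_of_baseChange_eq (hU.trans (h.baseChange_weightForm n).symm)

/-- `U_n ⊆ W_n`. [cite: GreenGriffithsKerr2012, §I.C (I.C.7)] -/
theorem weightForm_le_W (h : H.IsSplitOverQ) (n : ℤ) : h.weightForm n ≤ H.W n :=
  le_of_baseChange_le (by rw [h.baseChange_weightForm]; exact H.deligneE_le_baseChange_W n)

/-- `U_n ∩ W_{n-1} = 0`. [cite: GreenGriffithsKerr2012, §I.C (I.C.7)] -/
theorem weightForm_inf_W_pred (h : H.IsSplitOverQ) (n : ℤ) : h.weightForm n ⊓ H.W (n - 1) = ⊥ :=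
  inf_eq_bot_of_baseChange (by rw [h.baseChange_weightForm]; exact H.deligneE_inf_baseChange_W_pred n)

/-- `U_m ∩ W_n = 0` for `n < m`. [cite: GreenGriffithsKerr2012, §I.C (I.C.7)] -/
theorem weightForm_inf_W_of_lt (h : H.IsSplitOverQ) {n m : ℤ} (hnm : n < m) : h.weightForm m ⊓ H.W n = ⊥ :=
  inf_eq_bot_of_baseChange (by rw [h.baseChange_weightForm]; exact H.deligneE_inf_baseChange_W_of_lt hnm)

/-- **`W_n = W_{n-1} ⊕ U_n`** (the sum). [cite: GreenGriffithsKerr2012, §I.C (I.C.7)] -/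
theorem W_pred_sup_weightForm (h : H.IsSplitOverQ) (n : ℤ) : H.W (n - 1) ⊔ h.weightForm n = H.W n :=
  eq_of_baseChange_eq (by
    rw [baseChange_sup ℂ, h.baseChange_weightForm, H.baseChange_W_eq_baseChange_W_pred_sup_deligneE n])

/-- `U_n = 0` when `W_n = 0`. [cite: GreenGriffithsKerr2012, §I.C (I.C.7)] -/
theorem weightForm_eq_bot_of_W_eq_bot (h : H.IsSplitOverQ) {n : ℤ} (hn : H.W n = ⊥) : h.weightForm n = ⊥ :=
  eq_bot_iff.2 ((h.weightForm_le_W n).trans hn.le)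

/-- `U_n = 0` when `W_{n-1} = V`. [cite: GreenGriffithsKerr2012, §I.C (I.C.7)] -/
theorem weightForm_eq_bot_of_W_pred_eq_top (h : H.IsSplitOverQ) {n : ℤ} (hn : H.W (n - 1) = ⊤) : h.weightForm n = ⊥ := by
  rw [← inf_top_eq (h.weightForm n), ← hn]
  exact h.weightForm_inf_W_pred n

/-- **Only finitely many weight pieces are non-zero**: there is a finite set `s` of weights with `U_n = 0`
for `n ∉ s`. [cite: GreenGriffithsKerr2012, §I.C (I.C.7)] -/
theorem exists_finset_weightForm_eq_bot (h : H.IsSplitOverQ) : ∃ s : Finset ℤ, ∀ n, n ∉ s → h.weightForm n = ⊥ := by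
  obtain ⟨b, hb⟩ := H.exists_W_eq_bot
  obtain ⟨t, ht⟩ := H.exists_W_eq_top
  refine ⟨Finset.Ioc b (t + 1), fun n hn => ?_⟩
  rw [Finset.mem_Ioc, not_and_or, not_lt, not_le] at hn
  rcases hn with hn | hn
  · exact h.weightForm_eq_bot_of_W_eq_bot (eq_bot_iff.2 ((H.monotone_W hn).trans hb.le))
  · exact h.weightForm_eq_bot_of_W_pred_eq_top (eq_top_iff.2 (ht.ge.trans (H.monotone_W (by omega))))

/-- **The weight pieces are independent.** [cite: GreenGriffithsKerr2012, §I.C (I.C.7)] -/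
theorem iSupIndep_weightForm (h : H.IsSplitOverQ) : iSupIndep h.weightForm := by
  intro n
  rw [disjoint_iff]
  refine inf_eq_bot_of_baseChange ?_
  have h2 : (⨆ (m : ℤ) (_ : m ≠ n), h.weightForm m).baseChange ℂ =
      ⨆ pq ∈ {pq : ℤ × ℤ | pq.1 + pq.2 ∈ ({n}ᶜ : Set ℤ)}, H.deligneFamily pq := by
    rw [← H.biSup_deligneE_eq, baseChange_iSup ℂ]
    refine iSup_congr fun m => ?_
    rw [baseChange_iSup ℂ, h.baseChange_weightForm]
    exact le_antisymm (iSup_le fun hm => le_iSup_of_le (show m ∈ ({n}ᶜ : Set ℤ) from hm) le_rfl)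
      (iSup_le fun hm => le_iSup_of_le (show m ≠ n from hm) le_rfl)
  rw [h.baseChange_weightForm, H.deligneE_eq_biSup_mem, h2, H.biSup_deligneFamily_inf_biSup,
    show ({pq : ℤ × ℤ | pq.1 + pq.2 = n} ∩ {pq : ℤ × ℤ | pq.1 + pq.2 ∈ ({n}ᶜ : Set ℤ)}) = ∅ from
      Set.eq_empty_iff_forall_notMem.2 fun pq ⟨h1, h3⟩ => h3 h1]
  simp

/-- **The weight pieces span `V`**: `Σ_n U_n = V`. [cite: GreenGriffithsKerr2012, §I.C (I.C.7)] -/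
theorem iSup_weightForm_eq_top (h : H.IsSplitOverQ) : ⨆ n, h.weightForm n = ⊤ := by
  refine eq_of_baseChange_eq ?_
  rw [baseChange_iSup ℂ, Submodule.baseChange_top, eq_top_iff, ← H.iSup_deligneFamily_eq_top]
  refine iSup_le fun pq => le_iSup_of_le (pq.1 + pq.2) ?_
  rw [h.baseChange_weightForm]
  exact H.deligneI_le_deligneE rfl

/-- `Σ_{n ∈ s} U_n = V` for a finite set `s` of weights carrying all non-zero pieces.
[cite: GreenGriffithsKerr2012, §I.C (I.C.7)] -/
theorem biSup_weightForm_eq_top (h : H.IsSplitOverQ) {s : Finset ℤ} (hs : ∀ n, n ∉ s → h.weightForm n = ⊥) :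
    ⨆ n ∈ s, h.weightForm n = ⊤ := by
  rw [eq_top_iff, ← h.iSup_weightForm_eq_top]
  refine iSup_le fun n => ?_
  by_cases hn : n ∈ s
  · exact le_iSup₂_of_le (f := fun n (_ : n ∈ s) => h.weightForm n) n hn le_rfl
  · rw [hs n hn]
    exact bot_le

/-- **The weight piece `U_n` as a sub-mixed Hodge structure** (`(U_n)_ℂ = E_n` is a sum of `I^{p,q}`'s).
[cite: GreenGriffithsKerr2012, §I.C (I.C.7)–(I.C.8)] -/
def weightPiece (h : H.IsSplitOverQ) (n : ℤ) : SubMixedHodgeStructure H :=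
  SubMixedHodgeStructure.ofCompatible H (h.weightForm n) (by
    rw [h.baseChange_weightForm, H.deligneE_eq_biSup_mem]
    exact iSup₂_le fun pq hpq => le_iSup_of_le pq (le_inf
      (le_iSup₂_of_le (f := fun (pq : ℤ × ℤ) (_ : pq ∈ {pq : ℤ × ℤ | pq.1 + pq.2 = n}) => H.deligneFamily pq)
        pq hpq le_rfl) le_rfl))

/-- The underlying subspace of `weightPiece n` is `U_n` (by `rfl`). [cite: GreenGriffithsKerr2012, §I.C (I.C.7)] -/
@[simp]
theorem weightPiece_toSubmodule (h : H.IsSplitOverQ) (n : ℤ) : (h.weightPiece n).toSubmodule = h.weightForm n := rfl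

/-- **`U_n` is pure of weight `n`**: `W_{n-1}(U_n) = 0`. [cite: GreenGriffithsKerr2012, §I.C (I.C.7)] -/
theorem weightPiece_W_pred (h : H.IsSplitOverQ) (n : ℤ) : (h.weightPiece n).toMixedHodgeStructure.W (n - 1) = ⊥ := by
  rw [eq_bot_iff]
  intro x hx
  have hx' : (x : V) ∈ h.weightForm n ⊓ H.W (n - 1) := ⟨x.2, hx⟩
  rw [h.weightForm_inf_W_pred n, Submodule.mem_bot] at hx'
  exact (Submodule.mem_bot _).2 (Subtype.ext hx')

/-- **`U_n` is pure of weight `n`**: `W_n(U_n) = U_n`. [cite: GreenGriffithsKerr2012, §I.C (I.C.7)] -/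
theorem weightPiece_W_self (h : H.IsSplitOverQ) (n : ℤ) : (h.weightPiece n).toMixedHodgeStructure.W n = ⊤ :=
  eq_top_iff.2 fun x _ => h.weightForm_le_W n x.2

/-- The weight filtration of `U_n` is the one-step filtration at `n`. [cite: GreenGriffithsKerr2012, §I.C (I.C.7)] -/
theorem weightPiece_W (h : H.IsSplitOverQ) (n k : ℤ) :
    (h.weightPiece n).toMixedHodgeStructure.W k = if k < n then ⊥ else ⊤ := by
  split_ifs with hk
  · exact eq_bot_iff.2 (((h.weightPiece n).toMixedHodgeStructure.monotone_W (show k ≤ n - 1 by omega)).trans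
      (h.weightPiece_W_pred n).le)
  · exact eq_top_iff.2 ((h.weightPiece_W_self n).ge.trans
      ((h.weightPiece n).toMixedHodgeStructure.monotone_W (not_lt.1 hk)))

/-! ### §3 `H = ⊕ₙ U_n ≅ ⊕ₙ Gr^W_n H` as mixed Hodge structures -/

/-- **The morphism `⊕_{n ∈ s} U_n → H`**, `(u_n) ↦ Σ u_n`. [cite: GreenGriffithsKerr2012, §I.C (I.C.7)] -/
def piWeightPieceHom (h : H.IsSplitOverQ) (s : Finset ℤ) :
    Hom (pi fun n : ↥s => (h.weightPiece n).toMixedHodgeStructure) H :=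
  Hom.piDesc (fun n : ↥s => (h.weightPiece n).toMixedHodgeStructure) fun n => (h.weightPiece (n : ℤ)).subtype

/-- `piWeightPieceHom (u) = Σ_{n ∈ s} u_n`. [cite: GreenGriffithsKerr2012, §I.C (I.C.7)] -/
theorem piWeightPieceHom_toLinearMap_apply (h : H.IsSplitOverQ) (s : Finset ℤ) (u : ∀ n : ↥s, ↥(h.weightForm n)) :
    (h.piWeightPieceHom s).toLinearMap u = ∑ n : ↥s, (u n : V) :=
  Hom.piDesc_toLinearMap_apply _ u

/-- `⊕_{n ∈ s} U_n → H` is injective (the pieces are independent). [cite: GreenGriffithsKerr2012, §I.C (I.C.7)] -/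
theorem piWeightPieceHom_injective (h : H.IsSplitOverQ) (s : Finset ℤ) :
    Function.Injective (h.piWeightPieceHom s).toLinearMap := by
  have hind : iSupIndep fun n : ↥s => h.weightForm n := h.iSupIndep_weightForm.comp Subtype.val_injective
  rw [← LinearMap.ker_eq_bot, eq_bot_iff]
  intro u hu
  rw [LinearMap.mem_ker, piWeightPieceHom_toLinearMap_apply] at hu
  rw [Submodule.mem_bot]
  refine funext fun n => ?_
  have hsum : (u n : V) = -∑ m ∈ Finset.univ.erase n, (u m : V) := by
    rw [eq_neg_iff_add_eq_zero, Finset.add_sum_erase _ (fun m => (u m : V)) (Finset.mem_univ n)]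
    exact hu
  have hmem : (u n : V) ∈ h.weightForm n ⊓ ⨆ (m : ↥s) (_ : m ≠ n), h.weightForm m := by
    refine ⟨(u n).2, ?_⟩
    rw [hsum]
    exact Submodule.neg_mem _ ((iSup₂_le fun m hm =>
      le_iSup₂_of_le (f := fun (m : ↥s) (_ : m ≠ n) => h.weightForm (m : ℤ)) m (Finset.ne_of_mem_erase hm) le_rfl)
        (Submodule.sum_mem_biSup fun m _ => (u m).2))
  have h0 : (u n : V) = 0 := (Submodule.mem_bot ℚ).1 ((hind n).le_bot hmem)
  exact Submodule.coe_eq_zero.1 h0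

/-- `⊕_{n ∈ s} U_n → H` is surjective when `s` carries all non-zero pieces. [cite: GreenGriffithsKerr2012, §I.C (I.C.7)] -/
theorem piWeightPieceHom_surjective (h : H.IsSplitOverQ) {s : Finset ℤ} (hs : ∀ n, n ∉ s → h.weightForm n = ⊥) :
    Function.Surjective (h.piWeightPieceHom s).toLinearMap := by
  rw [← LinearMap.range_eq_top, eq_top_iff, ← h.biSup_weightForm_eq_top hs]
  refine iSup₂_le fun n hn => ?_
  intro x hx
  refine ⟨Pi.single (⟨n, hn⟩ : ↥s) ⟨x, hx⟩, ?_⟩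
  rw [piWeightPieceHom_toLinearMap_apply, Finset.sum_eq_single (⟨n, hn⟩ : ↥s)
    (fun m _ hm => by rw [Pi.single_eq_of_ne hm]; rfl) (fun h' => absurd (Finset.mem_univ _) h'), Pi.single_eq_same]

/-- **`⊕_{n ∈ s} U_n ⥲ H` is a bijective morphism of mixed Hodge structures** (`s` any finite set of weights
carrying the non-zero pieces, e.g. from `exists_finset_weightForm_eq_bot`). [cite: GreenGriffithsKerr2012, §I.C (I.C.7)] -/
theorem piWeightPieceHom_bijective (h : H.IsSplitOverQ) {s : Finset ℤ} (hs : ∀ n, n ∉ s → h.weightForm n = ⊥) :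
    Function.Bijective (h.piWeightPieceHom s).toLinearMap :=
  ⟨h.piWeightPieceHom_injective s, h.piWeightPieceHom_surjective hs⟩

/-- **The morphism `U_n → Gr^W_n H`**, `u ↦ [u]` (inclusion `U_n ⊆ W_n H` followed by the projection).
[cite: CattaniElZeinGriffithsLe2014, Def. 3.2.15] -/
def weightPieceGrHom (h : H.IsSplitOverQ) (n : ℤ) :
    Hom (h.weightPiece n).toMixedHodgeStructure (H.gr n).toMixedHodgeStructure :=
  (SubMixedHodgeStructure.weightGrMkQ H n).comp
    (SubMixedHodgeStructure.inclusion (S := h.weightPiece n) (T := SubMixedHodgeStructure.weight H n)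
      (h.weightForm_le_W n))

/-- `weightPieceGrHom (u) = [u]` (by `rfl`). [cite: CattaniElZeinGriffithsLe2014, Def. 3.2.15] -/
@[simp]
theorem weightPieceGrHom_toLinearMap_apply (h : H.IsSplitOverQ) (n : ℤ) (u : ↥(h.weightForm n)) :
    (h.weightPieceGrHom n).toLinearMap u = Submodule.Quotient.mk ⟨(u : V), h.weightForm_le_W n u.2⟩ := rfl

/-- **`U_n ⥲ Gr^W_n H`.** [cite: GreenGriffithsKerr2012, §I.C (I.C.7)–(I.C.8)] -/
theorem weightPieceGrHom_bijective (h : H.IsSplitOverQ) (n : ℤ) : Function.Bijective (h.weightPieceGrHom n).toLinearMap := by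
  constructor
  · rw [← LinearMap.ker_eq_bot, eq_bot_iff]
    intro u hu
    rw [LinearMap.mem_ker, weightPieceGrHom_toLinearMap_apply, Submodule.Quotient.mk_eq_zero] at hu
    have hu' : (u : V) ∈ h.weightForm n ⊓ H.W (n - 1) := ⟨u.2, hu⟩
    rw [h.weightForm_inf_W_pred n, Submodule.mem_bot] at hu'
    exact (Submodule.mem_bot ℚ).2 (Submodule.coe_eq_zero.1 hu')
  · intro y
    induction y using Submodule.Quotient.induction_on with
    | _ w =>
      have hw : (w : V) ∈ H.W (n - 1) ⊔ h.weightForm n := by rw [h.W_pred_sup_weightForm n]; exact w.2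
      obtain ⟨a, ha, u, hu, hau⟩ := Submodule.mem_sup.1 hw
      refine ⟨⟨u, hu⟩, ?_⟩
      rw [weightPieceGrHom_toLinearMap_apply]
      refine (Submodule.Quotient.eq _).2 ?_
      change ((u : V) - (w : V)) ∈ H.W (n - 1)
      rw [← hau, sub_add_cancel_right]
      exact Submodule.neg_mem _ ha

/-- **A `ℚ`-split mixed Hodge structure is isomorphic to the direct sum of its graded pieces**:
`⊕_{n ∈ s} Gr^W_n H ⥲ H` for any finite set `s` of weights carrying the non-zero pieces ("`ℚ`-split MHS, i.e.
general Hodge structures" `V^split = ⊕ Gr^W_i V`). [cite: GreenGriffithsKerr2012, §I.C (I.C.7), footnote 3] -/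
theorem exists_hom_pi_gr_bijective (h : H.IsSplitOverQ) {s : Finset ℤ} (hs : ∀ n, n ∉ s → h.weightForm n = ⊥) :
    ∃ f : Hom (pi fun n : ↥s => (H.gr n).toMixedHodgeStructure) H, Function.Bijective f.toLinearMap := by
  refine ⟨(h.piWeightPieceHom s).comp (Hom.piMap fun n : ↥s =>
    (h.weightPieceGrHom n).inverse (h.weightPieceGrHom_bijective n)), ?_⟩
  rw [Hom.comp_toLinearMap, LinearMap.coe_comp]
  exact (h.piWeightPieceHom_bijective hs).comp (Hom.piMap_bijective _ fun n =>
    (LinearEquiv.ofBijective _ (h.weightPieceGrHom_bijective n)).symm.bijective)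

/-- The same with the finite set of weights existentially quantified. [cite: GreenGriffithsKerr2012, §I.C (I.C.7), footnote 3] -/
theorem exists_finset_hom_pi_gr_bijective (h : H.IsSplitOverQ) :
    ∃ (s : Finset ℤ) (f : Hom (pi fun n : ↥s => (H.gr n).toMixedHodgeStructure) H), Function.Bijective f.toLinearMap := by
  obtain ⟨s, hs⟩ := h.exists_finset_weightForm_eq_bot
  obtain ⟨f, hf⟩ := h.exists_hom_pi_gr_bijective hs
  exact ⟨s, f, hf⟩

end IsSplitOverQ

/-! ### §4 Direct sums -/

section Pi

variable {ι : Type w} [Fintype ι] [DecidableEq ι]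
variable {W : ι → Type v} [∀ j, AddCommGroup (W j)] [∀ j, Module ℚ (W j)]

/-- **`E_n(⊕ⱼ Hⱼ) = Π E_n(Hⱼ)`** (under `piEquiv`). [cite: CattaniElZeinGriffithsLe2014, Ex. 3.2.23 (2)] -/
theorem deligneE_pi (Hs : ∀ j, MixedHodgeStructure (W j)) (n : ℤ) :
    (pi Hs).deligneE n =
      (Submodule.pi Set.univ fun j => (Hs j).deligneE n).comap (HodgeStructure.piEquiv W : ℂ ⊗[ℚ] (∀ j, W j) →ₗ[ℂ] ∀ j, ℂ ⊗[ℚ] W j) := by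
  have h1 : ∀ pq : ℤ × ℤ, (pi Hs).deligneFamily pq =
      (Submodule.pi Set.univ fun j => (Hs j).deligneFamily pq).comap
        (HodgeStructure.piEquiv W : ℂ ⊗[ℚ] (∀ j, W j) →ₗ[ℂ] ∀ j, ℂ ⊗[ℚ] W j) :=
    fun pq => deligneI_pi Hs pq.1 pq.2
  simp only [deligneE, h1, ← comap_piEquiv_iSup, ← pi_iSup]

/-- **Direct sums of `ℚ`-split mixed Hodge structures are `ℚ`-split.** [cite: GreenGriffithsKerr2012, §I.C (I.C.7)] -/
theorem isSplitOverQ_pi {Hs : ∀ j, MixedHodgeStructure (W j)} (h : ∀ j, (Hs j).IsSplitOverQ) : (pi Hs).IsSplitOverQ :=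
  fun n => ⟨Submodule.pi Set.univ fun j => (h j).weightForm n, by
    rw [baseChange_pi, deligneE_pi]
    simp only [IsSplitOverQ.baseChange_weightForm]⟩

/-- **Summands of a `ℚ`-split direct sum are `ℚ`-split** (`Hⱼ ≅ im(singleⱼ)`, a sub-MHS).
[cite: GreenGriffithsKerr2012, §I.C (I.C.7)] -/
theorem IsSplitOverQ.of_pi [∀ j, FiniteDimensional ℚ (W j)] {Hs : ∀ j, MixedHodgeStructure (W j)}
    (h : (pi Hs).IsSplitOverQ) (j : ι) : (Hs j).IsSplitOverQ := by
  have hb : Function.Bijective (Hom.single Hs j).rangeRestrict.toLinearMap :=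
    ⟨fun x y hxy => Hom.single_injective j (by
        have h' := congrArg (fun z : ↥(Hom.single Hs j).range.toSubmodule => (z : ∀ j, W j)) hxy
        simpa only [Hom.coe_rangeRestrict_apply] using h'),
      (Hom.single Hs j).rangeRestrict_surjective⟩
  exact (isSplitOverQ_iff_of_bijective _ hb).2 (h.range' (Hom.single Hs j))

end Pi

end MixedHodgeStructure

end Literature.AlgebraicGeometry.Motives
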